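import Mathlib.Analysis.InnerProductSpace.Basic
import Literature.MathematicalPhysics.QuantumFieldTheory.Balaban1983to89.B4Eq19LatticeOperators
import HarnessLib

/-!
# Crux stmt-QuantumFields-19936 `UnitScaleTilt.HistoryTailL`, route crux `PoincareLipschitz.BlockLipschitzL` (stmt-QuantumFields-23533), K2 organ «LOC-REG-MIN» (`hRegH`) —
# [T2] FILE 3: TWIST SLACK — an exact local minimiser of the TWISTED lattice energy `Σ‖τ μ y (u(y+e_μ)) − u y‖²` (twists `τ μ y : V ≃ₗᵢ V` with defect
# `‖τw − w‖ ≤ τ₀‖w‖`) is an ALMOST-minimiser of the FLAT energy `Σ‖u(y+e_μ) − u y‖²`, with additive slack `2τ₀(√(N·E(u)) + √(N·E(v))) + 2τ₀²N`, `N = d·#Q`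
# — one Cauchy–Schwarz; in normalised units at scale `R` (d = 3, `τ₀ ≍ θR`) the slack is `≍ θR²√φ + θ²R⁴`, small exactly where `hRegH`'s balance `R ≍ θ^{−1∕2}` lives

Cell `ym3-torus` (YM ladder rung R3 = continuum SU(2) Yang–Mills on T³ — a RUNG, NOT the Clay problem: not d = 4, not infinite volume, not a mass gap); LEAD
seat `ym-ust-19936-w1` g8 (bus 2026-08-29T06:02Z «ONE LOCATED INTERFACE POINT + CLAIM [T2] FILE 3»).  Helper `--supports stmt-QuantumFields-19936`; THEOREMS ONLY
(0 `def`, 0 `sorry`, default heartbeats), `V` ANY real inner-product space, `d` any dimension, letters of lit ✓`B4Eq19LatticeOperators` (`Zd`, `box`, `unitVec`)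
and of ✓`PoincareLipschitzCovariantCaccioppoli` (`τ : Fin d → Zd d → (V ≃ₗᵢ[ℝ] V)`).  Nothing here proves `hImprove`, `hRegH`, a chart, a stub, `BlockLipschitzL`,
`HistoryTailL` or a summit statement.

WHY.  In the K2 end-game knit `hRegH ⟸ hImprove ∧ [A] ∧ [T2] ∧ [C] ∧ [D]` the lane [C] (E→R: small energy ⇒ small range, ✓`…SphereMapHarmonicExtensionNearSphere` …
✓`…SmallEnergyHolderLaw`) is FLAT (`τ ≡ refl`) and uses MINIMALITY once, while [T2] FILE 2 ✓`PoincareLipschitzOrbitMinFlatShadow.localMin_of_dictionary` delivers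
EXACT minimality for the TWISTED energy of the orbit minimiser's flat shadow (twist defect `τ₀ = 4(d−1)(n−1)θ` after ✓`…OrbitMinBoxEnergy.dist1_regauge`).  This file
is the interface: the flat minimality-with-slack clause, so that no twisted twin of the E→R road is needed ([D], px7's small-range lane, is exact-twisted and uses
only one-site optimality).

WHAT IS PROVED (ns `…Theorems.PoincareLipschitzOrbitMinTwistSlack`).
* §1 `normSq_twist_sub_eq` (`‖τa − b‖² − ‖a − b‖² = ‖τa − a‖² + 2⟪τa − a, a − b⟫` for a linear isometry `τ`), ★ `abs_normSq_twist_sub_le`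
  (`‖a‖ = 1`, `‖τw − w‖ ≤ τ₀‖w‖` ⟹ `|‖τa − b‖² − ‖a − b‖²| ≤ 2τ₀‖a − b‖ + τ₀²`).
* §2 `sum_sum_le_sqrt_card_mul` (Cauchy–Schwarz on `Q × Fin d`), ★★ `abs_energy_twist_sub_le` (`|E_τ(f;Q) − E(f;Q)| ≤ 2τ₀√((d·#Q)·E(f;Q)) + τ₀²(d·#Q)` for `f` unit
  at the far endpoints), `energy_twist_le`, `energy_le_twist` (the two one-sided forms).
* §3 ★★★ `flat_almostMin_of_twisted_localMin`: `u` unit, twisted-minimal on `Q_{R+1}(z)` among unit fields `= u` off `Q_R(z)` (✓`localMin_of_dictionary`'s clause,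
  taken as a hypothesis), defect `τ₀` on `Q_{R+1}(z)` ⟹ for every such `v`:
  `E(u;Q_{R+1}) ≤ E(v;Q_{R+1}) + 2τ₀(√(N·E(u;Q_{R+1})) + √(N·E(v;Q_{R+1}))) + 2τ₀²N`, `N = d·#Q_{R+1}(z)`.
HONEST SCOPE.  An interface inequality; nothing of the regularity of the minimisers.  YM₃ on T³ is rung R3, not Clay; YM gap NOT proved.

References: R. Schoen, K. Uhlenbeck, J. Diff. Geom. 17 (1982) 307–335 [SchoenUhlenbeck1982] (§2: minimisers and comparison maps); M. Giaquinta, Annals of Math.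
Studies 105 (1983) [Giaquinta1984] (Ch. III §1 p.64: quasi-minima with additive terms).
-/

set_option autoImplicit false

noncomputable section

open scoped BigOperators InnerProductSpace

namespace Summit.QuantumFields.YangMills.Theorems.PoincareLipschitzOrbitMinTwistSlack

open Literature.MathematicalPhysics.QuantumFieldTheory.Balaban1983to89
open B4Eq19LatticeOperators (Zd box unitVec)

variable {V : Type*} [NormedAddCommGroup V] [InnerProductSpace ℝ V]

/-! ## §1 One bond: twisting a unit vector by a near-identity isometry changes the bond energy by `≤ 2τ₀‖a − b‖ + τ₀²` -/

/-- **THE BOND IDENTITY**: for a linear isometry `τ`, `‖τa − b‖² − ‖a − b‖² = ‖τa − a‖² + 2⟪τa − a, a − b⟫`. [folklore] -/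
theorem normSq_twist_sub_eq (τ : V ≃ₗᵢ[ℝ] V) (a b : V) :
    ‖τ a - b‖ ^ 2 - ‖a - b‖ ^ 2 = ‖τ a - a‖ ^ 2 + 2 * ⟪τ a - a, a - b⟫_ℝ := by
  have h : τ a - b = (τ a - a) + (a - b) := by abel
  rw [h, ← real_inner_self_eq_norm_sq ((τ a - a) + (a - b)), ← real_inner_self_eq_norm_sq (a - b), ← real_inner_self_eq_norm_sq (τ a - a),
    inner_add_left, inner_add_right, inner_add_right, real_inner_comm (a - b) (τ a - a)]
  ring

/-- ★ **TWIST SLACK PER BOND**: `‖τ w − w‖ ≤ τ₀‖w‖` for all `w` and `‖a‖ = 1` ⟹ `|‖τa − b‖² − ‖a − b‖²| ≤ 2τ₀‖a − b‖ + τ₀²`. [folklore] -/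
theorem abs_normSq_twist_sub_le (τ : V ≃ₗᵢ[ℝ] V) {τ₀ : ℝ} (hτ : ∀ w, ‖τ w - w‖ ≤ τ₀ * ‖w‖) {a : V} (ha : ‖a‖ = 1) (b : V) :
    |‖τ a - b‖ ^ 2 - ‖a - b‖ ^ 2| ≤ 2 * τ₀ * ‖a - b‖ + τ₀ ^ 2 := by
  rw [normSq_twist_sub_eq]
  have h1 : ‖τ a - a‖ ≤ τ₀ := by simpa [ha] using hτ a
  have h2 : |⟪τ a - a, a - b⟫_ℝ| ≤ ‖τ a - a‖ * ‖a - b‖ := abs_real_inner_le_norm _ _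
  have h3 : ‖τ a - a‖ ^ 2 ≤ τ₀ ^ 2 := pow_le_pow_left₀ (norm_nonneg _) h1 2
  have h4 : ‖τ a - a‖ * ‖a - b‖ ≤ τ₀ * ‖a - b‖ := mul_le_mul_of_nonneg_right h1 (norm_nonneg _)
  rw [abs_le]
  constructor
  · nlinarith [abs_le.mp h2, sq_nonneg ‖τ a - a‖, norm_nonneg (a - b)]
  · nlinarith [abs_le.mp h2, norm_nonneg (a - b)]

/-! ## §2 One box: `|E_τ(f;Q) − E(f;Q)| ≤ 2τ₀√(N·E(f;Q)) + τ₀²N`, `N = d·#Q`, by one Cauchy–Schwarz -/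

variable {d : ℕ}

/-- `Σ_{y∈Q}Σ_μ g(y,μ) ≤ √((d·#Q)·Σ_{y∈Q}Σ_μ g(y,μ)²)` for `g ≥ 0` (Cauchy–Schwarz on `Q × {1,…,d}`). [folklore] -/
theorem sum_sum_le_sqrt_card_mul (Q : Finset (Zd d)) (g : Zd d → Fin d → ℝ) :
    ∑ y ∈ Q, ∑ μ, g y μ ≤ Real.sqrt ((d * Q.card : ℝ) * ∑ y ∈ Q, ∑ μ, g y μ ^ 2) := by
  have hcs := Finset.sum_mul_sq_le_sq_mul_sq (Q ×ˢ (Finset.univ : Finset (Fin d))) (fun _ => (1 : ℝ)) (fun p => g p.1 p.2)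
  rw [Finset.sum_product, Finset.sum_product, Finset.sum_product] at hcs
  simp only [one_pow, one_mul, Finset.sum_const, Finset.card_univ, Fintype.card_fin, nsmul_eq_mul, mul_one] at hcs
  refine Real.le_sqrt_of_sq_le ?_
  calc (∑ y ∈ Q, ∑ μ, g y μ) ^ 2 ≤ (Q.card : ℝ) * d * ∑ y ∈ Q, ∑ μ, g y μ ^ 2 := hcs
    _ = (d * Q.card : ℝ) * ∑ y ∈ Q, ∑ μ, g y μ ^ 2 := by ring

/-- ★★ **TWIST SLACK ON A BOX**: for a field `f` that is UNIT at the far endpoints `y + e_μ` (`y ∈ Q`) and twists with defect `τ₀` on `Q`,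
`|Σ_{y∈Q}Σ_μ‖τ μ y (f(y+e_μ)) − f y‖² − Σ_{y∈Q}Σ_μ‖f(y+e_μ) − f y‖²| ≤ 2τ₀·√((d·#Q)·Σ_{y∈Q}Σ_μ‖f(y+e_μ) − f y‖²) + τ₀²·(d·#Q)`. [folklore] -/
theorem abs_energy_twist_sub_le (τ : Fin d → Zd d → (V ≃ₗᵢ[ℝ] V)) {τ₀ : ℝ} (hτ0 : 0 ≤ τ₀) (Q : Finset (Zd d))
    (hτ : ∀ y ∈ Q, ∀ (μ : Fin d) (w : V), ‖τ μ y w - w‖ ≤ τ₀ * ‖w‖) (f : Zd d → V) (hf : ∀ y ∈ Q, ∀ μ : Fin d, ‖f (y + unitVec μ)‖ = 1) :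
    |(∑ y ∈ Q, ∑ μ, ‖τ μ y (f (y + unitVec μ)) - f y‖ ^ 2) - ∑ y ∈ Q, ∑ μ, ‖f (y + unitVec μ) - f y‖ ^ 2| ≤
      2 * τ₀ * Real.sqrt ((d * Q.card : ℝ) * ∑ y ∈ Q, ∑ μ, ‖f (y + unitVec μ) - f y‖ ^ 2) + τ₀ ^ 2 * (d * Q.card : ℝ) := by
  rw [← Finset.sum_sub_distrib]
  have hb : ∀ y ∈ Q, |∑ μ, ‖τ μ y (f (y + unitVec μ)) - f y‖ ^ 2 - ∑ μ, ‖f (y + unitVec μ) - f y‖ ^ 2| ≤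
      ∑ μ, (2 * τ₀ * ‖f (y + unitVec μ) - f y‖ + τ₀ ^ 2) := by
    intro y hy
    rw [← Finset.sum_sub_distrib]
    refine (Finset.abs_sum_le_sum_abs _ _).trans (Finset.sum_le_sum fun μ _ => ?_)
    exact abs_normSq_twist_sub_le (τ μ y) (hτ y hy μ) (hf y hy μ) _
  calc |∑ y ∈ Q, (∑ μ, ‖τ μ y (f (y + unitVec μ)) - f y‖ ^ 2 - ∑ μ, ‖f (y + unitVec μ) - f y‖ ^ 2)|
      ≤ ∑ y ∈ Q, |∑ μ, ‖τ μ y (f (y + unitVec μ)) - f y‖ ^ 2 - ∑ μ, ‖f (y + unitVec μ) - f y‖ ^ 2| := Finset.abs_sum_le_sum_abs _ _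
    _ ≤ ∑ y ∈ Q, ∑ μ, (2 * τ₀ * ‖f (y + unitVec μ) - f y‖ + τ₀ ^ 2) := Finset.sum_le_sum hb
    _ = 2 * τ₀ * (∑ y ∈ Q, ∑ μ, ‖f (y + unitVec μ) - f y‖) + τ₀ ^ 2 * (d * Q.card : ℝ) := by
        simp only [Finset.sum_add_distrib, Finset.sum_const, Finset.card_univ, Fintype.card_fin, nsmul_eq_mul, ← Finset.mul_sum]
        ring
    _ ≤ 2 * τ₀ * Real.sqrt ((d * Q.card : ℝ) * ∑ y ∈ Q, ∑ μ, ‖f (y + unitVec μ) - f y‖ ^ 2) + τ₀ ^ 2 * (d * Q.card : ℝ) := by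
        have := sum_sum_le_sqrt_card_mul Q (fun y μ => ‖f (y + unitVec μ) - f y‖)
        nlinarith

/-- The twisted energy is within the slack of the flat one: `E_τ ≤ E + 2τ₀√(N·E) + τ₀²N`. [folklore] -/
theorem energy_twist_le (τ : Fin d → Zd d → (V ≃ₗᵢ[ℝ] V)) {τ₀ : ℝ} (hτ0 : 0 ≤ τ₀) (Q : Finset (Zd d))
    (hτ : ∀ y ∈ Q, ∀ (μ : Fin d) (w : V), ‖τ μ y w - w‖ ≤ τ₀ * ‖w‖) (f : Zd d → V) (hf : ∀ y ∈ Q, ∀ μ : Fin d, ‖f (y + unitVec μ)‖ = 1) :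
    ∑ y ∈ Q, ∑ μ, ‖τ μ y (f (y + unitVec μ)) - f y‖ ^ 2 ≤
      (∑ y ∈ Q, ∑ μ, ‖f (y + unitVec μ) - f y‖ ^ 2) +
        (2 * τ₀ * Real.sqrt ((d * Q.card : ℝ) * ∑ y ∈ Q, ∑ μ, ‖f (y + unitVec μ) - f y‖ ^ 2) + τ₀ ^ 2 * (d * Q.card : ℝ)) := by
  have := (abs_le.mp (abs_energy_twist_sub_le τ hτ0 Q hτ f hf)).2
  linarith

/-- The flat energy is within the slack of the twisted one: `E ≤ E_τ + 2τ₀√(N·E) + τ₀²N`. [folklore] -/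
theorem energy_le_twist (τ : Fin d → Zd d → (V ≃ₗᵢ[ℝ] V)) {τ₀ : ℝ} (hτ0 : 0 ≤ τ₀) (Q : Finset (Zd d))
    (hτ : ∀ y ∈ Q, ∀ (μ : Fin d) (w : V), ‖τ μ y w - w‖ ≤ τ₀ * ‖w‖) (f : Zd d → V) (hf : ∀ y ∈ Q, ∀ μ : Fin d, ‖f (y + unitVec μ)‖ = 1) :
    ∑ y ∈ Q, ∑ μ, ‖f (y + unitVec μ) - f y‖ ^ 2 ≤
      (∑ y ∈ Q, ∑ μ, ‖τ μ y (f (y + unitVec μ)) - f y‖ ^ 2) +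
        (2 * τ₀ * Real.sqrt ((d * Q.card : ℝ) * ∑ y ∈ Q, ∑ μ, ‖f (y + unitVec μ) - f y‖ ^ 2) + τ₀ ^ 2 * (d * Q.card : ℝ)) := by
  have := (abs_le.mp (abs_energy_twist_sub_le τ hτ0 Q hτ f hf)).1
  linarith

/-! ## §3 ★★★ An exact local minimiser of the twisted energy is an almost-minimiser of the flat energy -/

/-- ★★★ **FLAT ALMOST-MINIMALITY FROM TWISTED MINIMALITY.**  Let `u` be unit and minimise the TWISTED box energy on `Q := Q_{R+1}(z)` among unit
fields agreeing with it off `Q_R(z)` (the clause ✓`PoincareLipschitzOrbitMinFlatShadow.localMin_of_dictionary` delivers), the twists having defect `τ₀` on `Q`.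
Then for every such competitor `v`, with `N = d·#Q` and FLAT energies `E(·) = Σ_{y∈Q}Σ_μ‖·(y+e_μ) − ·(y)‖²`:
`E(u) ≤ E(v) + 2τ₀(√(N·E(u)) + √(N·E(v))) + 2τ₀²N` — the minimality-with-slack clause the flat E→R one-step improvement consumes; in normalised units at scale
`R` the slack is `≍ θR²√φ + θ²R⁴`. [cite: SchoenUhlenbeck1982, §2; Giaquinta1984, Ch. III §1 p.64] -/
theorem flat_almostMin_of_twisted_localMin (τ : Fin d → Zd d → (V ≃ₗᵢ[ℝ] V)) {τ₀ : ℝ} (hτ0 : 0 ≤ τ₀) (z : Zd d) (R : ℤ)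
    (hτ : ∀ y ∈ box z (R + 1), ∀ (μ : Fin d) (w : V), ‖τ μ y w - w‖ ≤ τ₀ * ‖w‖)
    (u : Zd d → V) (hu1 : ∀ y, ‖u y‖ = 1)
    (hmin : ∀ v : Zd d → V, (∀ y, y ∉ box z R → v y = u y) → (∀ y ∈ box z R, ‖v y‖ = 1) →
      ∑ y ∈ box z (R + 1), ∑ μ, ‖τ μ y (u (y + unitVec μ)) - u y‖ ^ 2 ≤ ∑ y ∈ box z (R + 1), ∑ μ, ‖τ μ y (v (y + unitVec μ)) - v y‖ ^ 2)
    (v : Zd d → V) (hv : ∀ y, y ∉ box z R → v y = u y) (hv1 : ∀ y ∈ box z R, ‖v y‖ = 1) :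
    ∑ y ∈ box z (R + 1), ∑ μ, ‖u (y + unitVec μ) - u y‖ ^ 2 ≤
      (∑ y ∈ box z (R + 1), ∑ μ, ‖v (y + unitVec μ) - v y‖ ^ 2) +
        2 * τ₀ * (Real.sqrt ((d * (box z (R + 1)).card : ℝ) * ∑ y ∈ box z (R + 1), ∑ μ, ‖u (y + unitVec μ) - u y‖ ^ 2) +
          Real.sqrt ((d * (box z (R + 1)).card : ℝ) * ∑ y ∈ box z (R + 1), ∑ μ, ‖v (y + unitVec μ) - v y‖ ^ 2)) +
        2 * (τ₀ ^ 2 * (d * (box z (R + 1)).card : ℝ)) := by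
  have hv1' : ∀ y, ‖v y‖ = 1 := by
    intro y
    by_cases hy : y ∈ box z R
    · exact hv1 y hy
    · rw [hv y hy]; exact hu1 y
  have h1 := energy_le_twist τ hτ0 (box z (R + 1)) hτ u (fun y _ μ => hu1 _)
  have h2 := hmin v hv hv1
  have h3 := energy_twist_le τ hτ0 (box z (R + 1)) hτ v (fun y _ μ => hv1' _)
  linarith

end Summit.QuantumFields.YangMills.Theorems.PoincareLipschitzOrbitMinTwistSlack

end
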